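import Summits.QuantumFields.BalabanUV.T4Continuum.Support.NE3NestedBlockMeanCovariance
import HarnessLib

/-!
# T⁴ programme, node NE3, route H♮ (ρ-g22-2) · junction J-ne3r2-g8-1, file 4 — JENSEN FOR THE NESTED TRANSPORTED BLOCK MEAN:
# `‖bmeanIterW L (j+1) W μ z‖ ≤ M^{−d}Σ_{v∈[0,M)^d}‖μ(M•z+v)‖`, its `ℓ²` form `Σ_z M^d‖bmeanIterW … z‖² ≤ Σ_y‖μ y‖²`, and the `nhsNormSq` twin

Row NE3-R2 (unit `b2b-balaban-t4-ne3r2-p1`, gen 8; disprover note D-ne3r2-g8-2 on the owner's K6 ASSEMBLY BLUEPRINT ρ-g23-3, memo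
`HOME/t4/b2b-balaban-t4-ne3-p1/g23/D-ne3p1-g23-1.md`, located item (L1)).  WHY.  §2(b) of the blueprint weighs the loop pairings
`Σ_z hsR (ψ z) (loops_z(η′))` of K4-c with `ψ := bmeanIterW L k W ζ′` through `‖ψ z‖ ≤ M^{−d∕2}‖ζ′‖_{B(z)}` — Jensen for the NESTED mean
(unitary transports at every level of the averaging tower, flat weights composing over nested boxes); the tree had the sup form only
(K3 file 2 `NE3ExactLineSumsTower.norm_bmeanIterW_le_of_sup`).  THIS FILE (all [folklore]; 0 `def`, 0 sorry), on file 1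
`NE3NestedBlockMeanCovariance` (`norm_bmeanW_le_mean`, the class tools) and the block tiling `NE3BlockLineAverage.sum_periodBox_blocks`:
**`norm_bmeanIterW_le_mean`** (multi-level small-field class `IsUnitaryCfg W`, `0 ≤ x`, `LevelSmall d L j x`, `SmallField W x`, `L ≥ 1`:
`‖bmeanIterW L (j+1) W μ z‖ ≤ ((L^{j+1})^d)⁻¹·Σ_{v∈periodBox (L^{j+1})}‖μ((L^{j+1})•z + v)‖`), **`sum_norm_bmeanIterW_sq_le`**
(`Σ_{z∈periodBox N} (L^{j+1})^d·‖bmeanIterW L (j+1) W μ z‖² ≤ Σ_{y∈periodBox (L^{j+1}·N)}‖μ y‖²`, Jensen `NE3ExactLineSums.blockMean_norm_sq_le`;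
no periodicity hypothesis) and **`sum_nhsNormSq_bmeanIterW_le`** (K6's `nhsNormSq` currency, factor `card n` by `MatrixNorms`).

HONEST FRAMING.  Bookkeeping kinematics of OUR transported block means at a background in the multi-level small-field class; nothing
about Bałaban's minimisers; (P♮)_W, (ML_w) at `W ≠ 1`, T-E_w and NE3 are NOT proved here; spine PROVED 0∕9; finite T⁴ rung (B)+1 —
NOT infinite volume, NOT mass gap, NOT BetaPertH, NOT Clay.  ABSOLUTE RULE kept: no printed sentence is a hypothesis (context only:
[Balaban1985Averaging] (42) p. 23).  PLACEMENT: `Summits/QuantumFields/BalabanUV/`; moves nothing.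
HONEST DEPENDENCY: continuum YM on T⁴ ⇐ BetaPertH ∧ nine spine estimates (0/9 proved); BetaPertH ⇐ (D1) ∧ (D4) ∧ CAP+tail;
G-an2-4 gates asym, D1 and NE2/3/4.
-/

set_option autoImplicit false

open scoped BigOperators Matrix.Norms.L2Operator
open Finset

namespace Summit.QuantumFields.BalabanUV.T4Continuum.NE3NestedBlockMeanJensen

open Literature.MathematicalPhysics.QuantumFieldTheory.Balaban1983to89
open B7Prop1Explicit B7Prop2Explicit
open T4AveragingDeficitWall (IsUnitaryCfg SmallField Ad hol_flat bavg_flat)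
open T4AveragingDeficitNonAbelian (Ad_mul Ad_sub)
open AveragingDeficitTransport (norm_Ad_of_unitary mem_U1_of_unitary)
open AveragingDeficitNearIdentity (Ad_one norm_Ad_sub_le norm_hol_sub_one_le_of_bonds Ad_sum Ad_real_smul)
open AveragingDeficitChartCalculus (cavg)
open AveragingDeficitTwoLevelPrep (prop1Radius)
open AveragingDeficitMultiLevelPrep (cavgIter LevelSmall prop1Radius_nonneg)
open AveragingDeficitBlockDensity (btree bseg btree_mem norm_cavg_inv_bseg_sub_one_le cavg_mem)
open AveragingDeficitLocality (bondsOf)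
open AveragingDeficitTransportCalc (bondsOf_append mem_bondsOf_seg_iff)
open NE3TangentCovariantTower (step_small cavgIter_succ)
open NE3CovariantBlockMean (bmeanW bmeanIterW bmeanIterW_succ bmeanIterW_zero boxVec_bounds)
open NE3GaugeDirFrames (Ad_Ad_inv)
open NE3CombGauge (btree_corner norm_comb_sub_one_le_single isUnitaryCfg_comb smallField_comb)
open NE3FramePotGauge (bmean iterate_bmean_apply)
open NE3ExactLineSumsTower (sq_mul_loopRad_le DSum DSum_succ DSum_le_top)
open NE3ExactLineSums (blockMean_norm_sq_le)
open NE3BlockLineAverage (sum_univ_boxVec sum_periodBox_blocks)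
open SpreadLift (loopRad loopRad_le loopBound_of_smallField)
open T4AveragingDeficitWallBoundary (periodBox mem_periodBox)

open NE3NestedBlockMeanCovariance (norm_bmeanW_le_mean)
open MatrixNorms (nhsNormSq nhsNormSq_le_opNorm_sq opNorm_sq_le_card_mul_nhsNormSq)

noncomputable section

variable {d : ℕ} {n : Type*} [Fintype n] [DecidableEq n]

/-! ## §1 Jensen for the nested transported block mean -/

/-- **JENSEN FOR THE NESTED TRANSPORTED MEAN** (multi-level small-field class, `L ≥ 1`): `‖bmeanIterW L (j+1) W μ z‖ ≤ M^{−d}Σ_{v∈[0,M)^d}‖μ(M•z+v)‖`,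
`M = L^{j+1}` — every level is a convex combination with unitary transports (`norm_bmeanW_le_mean`), and the flat weights of the levels
compose over the nested boxes (`sum_periodBox_blocks`). [folklore] -/
theorem norm_bmeanIterW_le_mean [Nonempty n] {L : ℕ} (hL : 1 ≤ L) (j : ℕ) :
    ∀ {W : Site d → Fin d → (Matrix n n ℂ)ˣ} {x : ℝ}, IsUnitaryCfg W → 0 ≤ x → LevelSmall d L j x → SmallField W x →
    ∀ (mu : Site d → Matrix n n ℂ) (z : Site d),
      ‖bmeanIterW L (j + 1) W mu z‖
        ≤ (((L ^ (j + 1) : ℕ) : ℝ) ^ d)⁻¹ * ∑ v ∈ periodBox (d := d) (L ^ (j + 1)), ‖mu (((L ^ (j + 1) : ℕ) : ℤ) • z + v)‖ := by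
  induction j with
  | zero =>
      intro W x hWu _ _ _ mu z
      rw [bmeanIterW_succ, bmeanIterW_zero]
      simp only [zero_add, pow_one]
      have h := norm_bmeanW_le_mean (L := L) hWu mu z
      rw [Finset.mul_sum, ← sum_univ_boxVec L (fun v => ((L : ℝ) ^ d)⁻¹ * ‖mu ((L : ℤ) • z + v)‖)]
      exact h
  | succ j ih =>
      intro W x hWu hx hsm hWx mu z
      obtain ⟨-, hW₁u, hr0, hW₁x⟩ := step_small hL hWu hx hsm.1 hWx
      rw [bmeanIterW_succ]
      have hMK : ((L ^ (j + 1 + 1) : ℕ) : ℤ) = (L : ℤ) * ((L ^ (j + 1) : ℕ) : ℤ) := by push_cast; ring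
      have hI := ih hW₁u hr0 hsm.2 hW₁x (bmeanW L W mu) z
      have hKd : (0 : ℝ) ≤ (((L ^ (j + 1) : ℕ) : ℝ) ^ d)⁻¹ := by positivity
      -- Jensen at the finest level, block by block
      have hblock : ∀ v ∈ periodBox (d := d) (L ^ (j + 1)),
          ‖bmeanW L W mu (((L ^ (j + 1) : ℕ) : ℤ) • z + v)‖
            ≤ ∑ r : Fin d → Fin L, ((L : ℝ) ^ d)⁻¹ * ‖mu ((L : ℤ) • (((L ^ (j + 1) : ℕ) : ℤ) • z + v) + boxVec L r)‖ :=
        fun v _ => norm_bmeanW_le_mean hWu mu _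
      -- the composition of the sub-block means
      have hcomp : ∑ v ∈ periodBox (d := d) (L ^ (j + 1)),
            ∑ r : Fin d → Fin L, ((L : ℝ) ^ d)⁻¹ * ‖mu ((L : ℤ) • (((L ^ (j + 1) : ℕ) : ℤ) • z + v) + boxVec L r)‖
          = ((L : ℝ) ^ d)⁻¹ * ∑ w ∈ periodBox (d := d) (L ^ (j + 1 + 1)), ‖mu (((L ^ (j + 1 + 1) : ℕ) : ℤ) • z + w)‖ := by
        rw [Finset.mul_sum, pow_succ' L (j + 1),
          ← sum_periodBox_blocks L (L ^ (j + 1)) hL (fun w => ((L : ℝ) ^ d)⁻¹ * ‖mu (((L * L ^ (j + 1) : ℕ) : ℤ) • z + w)‖)]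
        refine Finset.sum_congr rfl fun v _ => ?_
        rw [sum_univ_boxVec L (fun u => ((L : ℝ) ^ d)⁻¹ * ‖mu ((L : ℤ) • (((L ^ (j + 1) : ℕ) : ℤ) • z + v) + u)‖)]
        refine Finset.sum_congr rfl fun u _ => ?_
        congr 3
        rw [smul_add, smul_smul, add_assoc]
        push_cast
        rfl
      have hinv : (((L ^ (j + 1) : ℕ) : ℝ) ^ d)⁻¹ * (((L : ℝ) ^ d)⁻¹
            * ∑ w ∈ periodBox (d := d) (L ^ (j + 1 + 1)), ‖mu (((L ^ (j + 1 + 1) : ℕ) : ℤ) • z + w)‖)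
          = (((L ^ (j + 1 + 1) : ℕ) : ℝ) ^ d)⁻¹ * ∑ w ∈ periodBox (d := d) (L ^ (j + 1 + 1)), ‖mu (((L ^ (j + 1 + 1) : ℕ) : ℤ) • z + w)‖ := by
        push_cast
        rw [← mul_assoc, ← mul_inv, ← mul_pow]
        ring
      calc ‖bmeanIterW L (j + 1) (cavg L W) (bmeanW L W mu) z‖
          ≤ (((L ^ (j + 1) : ℕ) : ℝ) ^ d)⁻¹ * ∑ v ∈ periodBox (d := d) (L ^ (j + 1)), ‖bmeanW L W mu (((L ^ (j + 1) : ℕ) : ℤ) • z + v)‖ := hI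
        _ ≤ (((L ^ (j + 1) : ℕ) : ℝ) ^ d)⁻¹ * ∑ v ∈ periodBox (d := d) (L ^ (j + 1)),
              ∑ r : Fin d → Fin L, ((L : ℝ) ^ d)⁻¹ * ‖mu ((L : ℤ) • (((L ^ (j + 1) : ℕ) : ℤ) • z + v) + boxVec L r)‖ :=
            mul_le_mul_of_nonneg_left (Finset.sum_le_sum hblock) hKd
        _ = _ := by rw [hcomp, hinv]

/-- **THE NESTED MEAN IN `ℓ²` OVER THE BLOCKS OF A TORUS** (same class; any `N`, no periodicity needed):
`Σ_{z∈[0,N)^d} M^d·‖bmeanIterW L (j+1) W μ z‖² ≤ Σ_{y∈[0,MN)^d}‖μ y‖²` (Jensen per block + the block tiling). [folklore] -/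
theorem sum_norm_bmeanIterW_sq_le [Nonempty n] {L : ℕ} (hL : 1 ≤ L) (j : ℕ) {W : Site d → Fin d → (Matrix n n ℂ)ˣ} {x : ℝ}
    (hWu : IsUnitaryCfg W) (hx : 0 ≤ x) (hsm : LevelSmall d L j x) (hWx : SmallField W x) (mu : Site d → Matrix n n ℂ) (N : ℕ) :
    ∑ z ∈ periodBox (d := d) N, ((L : ℝ) ^ (j + 1)) ^ d * ‖bmeanIterW L (j + 1) W mu z‖ ^ 2
      ≤ ∑ y ∈ periodBox (d := d) (L ^ (j + 1) * N), ‖mu y‖ ^ 2 := by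
  have hM1 : 1 ≤ L ^ (j + 1) := Nat.one_le_pow _ _ hL
  have hMr : ((L ^ (j + 1) : ℕ) : ℝ) = (L : ℝ) ^ (j + 1) := by push_cast; rfl
  have hMpos : (0 : ℝ) < ((L : ℝ) ^ (j + 1)) ^ d := by positivity
  rw [← sum_periodBox_blocks (L ^ (j + 1)) N hM1 (fun y => ‖mu y‖ ^ 2)]
  refine Finset.sum_le_sum fun z _ => ?_
  have h := norm_bmeanIterW_le_mean hL j hWu hx hsm hWx mu z
  have hJ := blockMean_norm_sq_le (n := n) hM1 mu (((L ^ (j + 1) : ℕ) : ℤ) • z)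
  rw [hMr] at hJ h
  have hmean : (((L : ℝ) ^ (j + 1)) ^ d)⁻¹ * ∑ v ∈ periodBox (d := d) (L ^ (j + 1)), ‖mu (((L ^ (j + 1) : ℕ) : ℤ) • z + v)‖
      = ∑ r : Fin d → Fin (L ^ (j + 1)), (((L : ℝ) ^ (j + 1)) ^ d)⁻¹ * ‖mu (((L ^ (j + 1) : ℕ) : ℤ) • z + boxVec (L ^ (j + 1)) r)‖ := by
    rw [Finset.mul_sum, sum_univ_boxVec (L ^ (j + 1)) (fun v => (((L : ℝ) ^ (j + 1)) ^ d)⁻¹ * ‖mu (((L ^ (j + 1) : ℕ) : ℤ) • z + v)‖)]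
  rw [hmean] at h
  have hsq : ∑ r : Fin d → Fin (L ^ (j + 1)), ‖mu (((L ^ (j + 1) : ℕ) : ℤ) • z + boxVec (L ^ (j + 1)) r)‖ ^ 2
      = ∑ v ∈ periodBox (d := d) (L ^ (j + 1)), ‖mu (((L ^ (j + 1) : ℕ) : ℤ) • z + v)‖ ^ 2 :=
    sum_univ_boxVec (L ^ (j + 1)) (fun v => ‖mu (((L ^ (j + 1) : ℕ) : ℤ) • z + v)‖ ^ 2)
  rw [hsq] at hJ
  have h0 : 0 ≤ ‖bmeanIterW L (j + 1) W mu z‖ := norm_nonneg _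
  have h2 := pow_le_pow_left₀ h0 h 2
  calc ((L : ℝ) ^ (j + 1)) ^ d * ‖bmeanIterW L (j + 1) W mu z‖ ^ 2
      ≤ ((L : ℝ) ^ (j + 1)) ^ d * ((((L : ℝ) ^ (j + 1)) ^ d)⁻¹
          * ∑ v ∈ periodBox (d := d) (L ^ (j + 1)), ‖mu (((L ^ (j + 1) : ℕ) : ℤ) • z + v)‖ ^ 2) :=
        mul_le_mul_of_nonneg_left (h2.trans hJ) hMpos.le
    _ = ∑ v ∈ periodBox (d := d) (L ^ (j + 1)), ‖mu (((L ^ (j + 1) : ℕ) : ℤ) • z + v)‖ ^ 2 := by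
        field_simp

/-- **THE NESTED MEAN IN K6's NORMALISED HILBERT–SCHMIDT CURRENCY**: `Σ_z M^d·nhsNormSq (bmeanIterW … z) ≤ card n·Σ_y nhsNormSq (μ y)`
(`nhsNormSq ≤ ‖·‖²_op ≤ card n·nhsNormSq`). [folklore] -/
theorem sum_nhsNormSq_bmeanIterW_le [Nonempty n] {L : ℕ} (hL : 1 ≤ L) (j : ℕ) {W : Site d → Fin d → (Matrix n n ℂ)ˣ} {x : ℝ}
    (hWu : IsUnitaryCfg W) (hx : 0 ≤ x) (hsm : LevelSmall d L j x) (hWx : SmallField W x) (mu : Site d → Matrix n n ℂ) (N : ℕ) :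
    ∑ z ∈ periodBox (d := d) N, ((L : ℝ) ^ (j + 1)) ^ d * nhsNormSq (bmeanIterW L (j + 1) W mu z)
      ≤ Fintype.card n * ∑ y ∈ periodBox (d := d) (L ^ (j + 1) * N), nhsNormSq (mu y) := by
  have h := sum_norm_bmeanIterW_sq_le hL j hWu hx hsm hWx mu N
  calc ∑ z ∈ periodBox (d := d) N, ((L : ℝ) ^ (j + 1)) ^ d * nhsNormSq (bmeanIterW L (j + 1) W mu z)
      ≤ ∑ z ∈ periodBox (d := d) N, ((L : ℝ) ^ (j + 1)) ^ d * ‖bmeanIterW L (j + 1) W mu z‖ ^ 2 :=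
        Finset.sum_le_sum fun z _ => mul_le_mul_of_nonneg_left (nhsNormSq_le_opNorm_sq _) (by positivity)
    _ ≤ ∑ y ∈ periodBox (d := d) (L ^ (j + 1) * N), ‖mu y‖ ^ 2 := h
    _ ≤ ∑ y ∈ periodBox (d := d) (L ^ (j + 1) * N), (Fintype.card n * nhsNormSq (mu y)) :=
        Finset.sum_le_sum fun y _ => opNorm_sq_le_card_mul_nhsNormSq _
    _ = _ := by rw [← Finset.mul_sum]

end

end Summit.QuantumFields.BalabanUV.T4Continuum.NE3NestedBlockMeanJensen
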